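import Literature.AnabelianGeometry.SemiGraphs.SgAGlobalPointStabilizers
import Literature.AnabelianGeometry.SemiGraphs.SgATemperedOfPointSystem
import Literature.AnabelianGeometry.SemiGraphs.TieBijective
import Literature.AnabelianGeometry.SemiGraphs.SgALocalizations
import Literature.AnabelianGeometry.SemiGraphs.AmbientVocabReal
import HarnessLib

/-!
# [SemiAnbd] Def. 3.5 (ii), "`B(G) ↪ B^temp(G)`", for the cell's ABSTRACT four-clause coverings: a
# finite étale arrow of the ambient category between connected objects IS a tempered covering — law L1
# of the (R1) bridge in full; the first disjunct of `SgA.IsTemperedArrow` is redundant (proof-only)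

Mochizuki, *Semi-graphs of anabelioids*, Publ. RIMS **42** (2006), Def. 2.2 (i) p. 23 (finite étale
coverings), Def. 3.5 (i)/(ii) p. 37 ("coverings of semi-graphs of anabelioids that arise from finite
objects of `B^cov(G)` determine 'finite étale coverings'"; tempered coverings; "`B(G) ↪ B^temp(G)`")
(kurims `paper:url-f33ace170ff4`). [cite: MochizukiSemiAnbd2006, Def 3.5(ii) p.37]

PROOF-ONLY assembly (abc-iut cell, layer L3; (R1) bridge of the [SemiAnbd] §§4–5 container, law L1
«finite étale ⇒ tempered covering», HOME/staging/L3/L3-t3/R1-BRIDGE-SHAPES.md §5; seat abc-iut-L3-t3).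
abc-iut-L3-t3 gen 5/6 proved L1 for print's CONSTRUCTED coverings (`SgA.isTemperedCoveringOf_coveringArrow`)
and reduced the abstract case to an aligned point system (`SgA.isTemperedCoveringOf_of_pointSystem_toCovObj`);
`SgAGlobalPointSystem.lean` / `SgAGlobalPointStabilizers.lean` supply (PS1)–(PS3) at the GLOBAL points of
any covering with a global witness (alignment clauses entering (PS2) only); abc-iut-f-161's (TIE)
`Hom.tie_bijective` supplies the bijectivity of the point lift.  Assembled here:

* `Hom.pointLift_vertexMap_bijective_glob` / `…edgeMap…` — the point lift at the global points is
  bijective on vertices and edges ((TIE) + the label membership of the global points +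
  abc-iut-L3-t3's choice-agnostic `HomOver.pointLift_vertex_bijective`);
* `Hom.isoOverGlob` is NOT a definition here: `Hom.nonempty_isoOver_toCovObj` — **every four-clause
  covering `ψ : ℋ → 𝒦` of CONNECTED semi-graphs of anabelioids with every edge abutting, read on
  profinite presentations, is ISOMORPHIC OVER `𝒦` to the covering of the finite object `toCovObj A` of
  `B^cov(𝒦)`** (Def. 2.2 (i) ↔ Def. 3.5 (i) for abstract coverings);
* ★ `SgA.isTemperedCoveringOf_of_finiteEtale` — **law L1 in full**: a finite étale arrow `f : H → G` of
  the ambient category `SgA` (`finiteEtale f` = the class of ANY `Hom.IsFiniteEtaleCoveringGlobal`) between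
  CONNECTED objects, `G` countable, is a tempered covering (`SgA.IsTemperedCoveringOf`, Def. 3.5 (ii));
* `SgA.isTemperedArrow_iff_isTemperedCoveringOf`, `SemiAnbdVocab.real_isTempered_iff_isTemperedCoveringOf`
  — hence the tempered arrows of the container `SemiAnbdVocab.real` between connected objects over a
  countable target are EXACTLY the honest tempered coverings of Def. 3.5 (ii): the first disjunct of
  abc-iut-L3-t3's `SgA.IsTemperedArrow := finiteEtale ∨ IsTemperedCoveringOf` is redundant there.

Residual (recorded, not asserted): disconnected sources (abc-iut-f-161's (TIE) is stated for connected
`ℋ`, `𝒦`; the disconnected case is componentwise).  No `def`, no new `Prop`; nothing here takes a side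
on [IUTchIII] Cor. 3.12.
-/

noncomputable section

namespace Literature.AnabelianGeometry.SemiGraphs

open CategoryTheory CategoryTheory.Limits CategoryTheory.PreGaloisCategory
open Literature.AnabelianGeometry.Anabelioids

universe u

namespace SemiGraphOfAnabelioids

namespace Hom

variable {ℋ 𝒦 : SemiGraphOfAnabelioids.{u, u, u}} (ψ : Hom ℋ 𝒦) (A : 𝒦.BObj)
  [HasBinaryProducts 𝒦.BObj] (αψ : Over A ⥤ ℋ.BObj) [αψ.IsEquivalence]
  (eψ : ψ.pullbackFunctor ≅ Over.star A ⋙ αψ)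

/-! ### Bijectivity of the point lift at the global points = abc-iut-f-161's (TIE) -/

/-- **The point lift at the global points is bijective on vertices**: the global vertex points lie in
abc-iut-f-161's canonical labels `O(w)` (`yGlob_mem_range_of_section_factors`), and `w ↦ (ψ w, O w)` is a
bijection ((TIE) `tie_bijective`); abc-iut-L3-t3's `HomOver.pointLift_vertex_bijective` converts labels
to orbits. [cite: MochizukiSemiAnbd2006, Def. 2.2(i) p.23] -/
theorem pointLift_vertexMap_bijective_glob (hloc : ψ.IsFiniteEtaleCoveringOf A)
    (hbr : ψ.IsBranchAligned) (hva : ψ.IsVertexAligned) (hℋ : ℋ.IsConnected) (h𝒦 : 𝒦.IsConnected) :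
    Function.Bijective ((BObj.toCovObj A).pointLift ψ.base (ψ.yGlob A αψ eψ)
      (fun e' => ψ.zGlob A αψ eψ e') (ψ.glueCondition_glob A αψ eψ)).vertexMap := by
  obtain ⟨O, OE, hO, -, hOiff, -, -⟩ := tie_bijective ψ A αψ eψ hloc hbr hva hℋ h𝒦
  exact ((BObj.toCovObj A).pointLift_vertexMap_bijective_iff _ _ _ _).mpr
    (HomOver.pointLift_vertex_bijective (𝒢 := ℋ) (f := ψ.base) (A := A) O (ψ.yGlob A αψ eψ) hO
      fun w => ψ.yGlob_mem_range_of_section_factors A αψ eψ w (O w) ((hOiff w (O w)).mp rfl))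

/-- **The point lift at the global points is bijective on edges** (edge twin).
[cite: MochizukiSemiAnbd2006, Def. 2.2(i) p.23] -/
theorem pointLift_edgeMap_bijective_glob (hloc : ψ.IsFiniteEtaleCoveringOf A)
    (hbr : ψ.IsBranchAligned) (hva : ψ.IsVertexAligned) (hℋ : ℋ.IsConnected) (h𝒦 : 𝒦.IsConnected) :
    Function.Bijective ((BObj.toCovObj A).pointLift ψ.base (ψ.yGlob A αψ eψ)
      (fun e' => ψ.zGlob A αψ eψ e') (ψ.glueCondition_glob A αψ eψ)).edgeMap := by
  obtain ⟨O, OE, -, hOE, -, hOEiff, -⟩ := tie_bijective ψ A αψ eψ hloc hbr hva hℋ h𝒦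
  exact ((BObj.toCovObj A).pointLift_edgeMap_bijective_iff _ _ _ _).mpr
    (HomOver.pointLift_edge_bijective (𝒢 := ℋ) (f := ψ.base) (A := A) OE
      (fun e' => ψ.zGlob A αψ eψ e') hOE
      fun e' => ψ.zGlob_mem_range_of_sectionE_factors A αψ eψ e' (OE e') ((hOEiff e' (OE e')).mp rfl))

/-! ### Def. 2.2 (i) ↔ Def. 3.5 (i) for abstract coverings: the isomorphism over the base -/

include αψ eψ in
/-- **An abstract four-clause covering, read on profinite presentations, is isomorphic over `𝒦` to the
covering of `toCovObj A ∈ B^cov(𝒦)`.**  For `ψ : ℋ → 𝒦` LOCALLY the covering attached to `A`, with a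
GLOBAL witness `(αψ, e_ψ)`, BRANCH- and VERTEX-ALIGNED, `ℋ`, `𝒦` connected and every edge of `ℋ`
abutting: `ψ.toProfinite ≅ (toCovObj A).coveringHom` over `𝒦.toProfinite` (abc-iut-L3-t2/L3-t3
`CovObj.pointIsoOver` at the global point system). [cite: MochizukiSemiAnbd2006, Def 3.5(i) p.37] -/
theorem nonempty_isoOver_toCovObj (hloc : ψ.IsFiniteEtaleCoveringOf A) (hbr : ψ.IsBranchAligned)
    (hva : ψ.IsVertexAligned) (hℋ : ℋ.IsConnected) (h𝒦 : 𝒦.IsConnected) (hab : ℋ.EveryEdgeAbuts) :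
    Nonempty (ProfiniteSemiGraph.Hom.IsoOver ψ.toProfinite (BObj.toCovObj A).coveringHom) :=
  ⟨(BObj.toCovObj A).pointIsoOver ψ.toProfinite (ψ.yGlob A αψ eψ) (fun e' => ψ.zGlob A αψ eψ e')
    (ψ.glueCondition_glob A αψ eψ) (ψ.stabCondition_glob A αψ eψ hloc hbr hva hab)
    (ψ.pointAligned_glob A αψ eψ) hloc.1
    (ψ.pointLift_vertexMap_bijective_glob A αψ eψ hloc hbr hva hℋ h𝒦)
    (ψ.pointLift_edgeMap_bijective_glob A αψ eψ hloc hbr hva hℋ h𝒦)⟩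

omit [HasBinaryProducts 𝒦.BObj] in
/-- **The same from the cell's covering notion of record** `Hom.IsFiniteEtaleCoveringGlobal`
(«local ∧ global ∧ branch-aligned ∧ vertex-aligned», abc-iut-L3-t1): for SOME `A ∈ B(𝒦)`, `ψ.toProfinite`
is isomorphic over `𝒦` to the covering of the finite object `toCovObj A`.
[cite: MochizukiSemiAnbd2006, Def 3.5(i) p.37] -/
theorem exists_isoOver_toCovObj_of_isFiniteEtaleCoveringGlobal (hψ : ψ.IsFiniteEtaleCoveringGlobal)
    (hℋ : ℋ.IsConnected) (h𝒦 : 𝒦.IsConnected) (hab : ℋ.EveryEdgeAbuts) :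
    ∃ A : 𝒦.BObj,
      Nonempty (ProfiniteSemiGraph.Hom.IsoOver ψ.toProfinite (BObj.toCovObj A).coveringHom) := by
  obtain ⟨A, hloc, ⟨hprod, αψ, hα, ⟨eψ⟩⟩, hbr, hva⟩ := hψ
  haveI := hprod
  haveI := hα
  exact ⟨A, ψ.nonempty_isoOver_toCovObj A αψ eψ hloc hbr hva hℋ h𝒦 hab⟩

end Hom

end SemiGraphOfAnabelioids

/-! ### Law L1 of the (R1) bridge in full: finite étale arrows of `SgA` are tempered coverings -/

namespace SgAQuot.SgA

open SemiGraphOfAnabelioids ProfiniteSemiGraph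

variable {H G : SgA.{u, u, u}} (f : H ⟶ G)

/-- Bookkeeping: a 1-morphism `φ` whose class is the `SgAQuot`-arrow `a` yields a representative of
`a` over `a.base` with the same profinite reading (`subst`). [cite: MochizukiSemiAnbd2006, Rmk 2.4.2, p. 26] -/
theorem exists_rep_of_homOf_eq {a : H.obj.obj ⟶ G.obj.obj} (φ : SemiGraphOfAnabelioids.Hom H.toSgA G.toSgA)
    (hφ : homOf φ = a) :
    ∃ φ' : HomOver H.toSgA G.toSgA a.base, homMk φ' = a ∧ φ'.toProfinite = φ.toProfinite := by
  subst hφ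
  exact ⟨φ.over, rfl, rfl⟩

/-- **Law L1 «finite étale ⇒ tempered» of the (R1) bridge, for the cell's ABSTRACT four-clause
coverings** ([SemiAnbd] Def. 3.5 (ii), "`B(G) ↪ B^temp(G)`"): a finite étale arrow `f : H → G` of the
ambient category `SgA` of §§4–5 (`finiteEtale f`: the class of a 1-morphism satisfying abc-iut-L3-t1's
`Hom.IsFiniteEtaleCoveringGlobal`) between CONNECTED objects, with `G` countable, is a TEMPERED
COVERING of `G` (`SgA.IsTemperedCoveringOf`: isomorphic over `G.toProfinite` to the covering of a
tempered — indeed finite — object of `B^cov(G)`).  Inputs: the global point system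
(`SgAGlobalPointSystem/Stabilizers`), abc-iut-f-161's (TIE), abc-iut-L3-t2's `FiniteIsTempered_holds`.
[cite: MochizukiSemiAnbd2006, Def 3.5(ii) p.37] -/
theorem isTemperedCoveringOf_of_finiteEtale (hH : H.toSgA.graph.IsConnected)
    (hG : G.toSgA.graph.IsConnected) (hκ : G.toSgA.graph.IsCountable) (h : finiteEtale f.hom.hom) :
    IsTemperedCoveringOf f := by
  obtain ⟨φ, hφ, hglob⟩ := h
  obtain ⟨φ', hφ', hprof⟩ := exists_rep_of_homOf_eq (H := H) (G := G) φ hφ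
  rw [isTemperedCoveringOf_indep f φ' hφ', IsTemperedCoveringVia, hprof]
  obtain ⟨A, hA⟩ := φ.exists_isoOver_toCovObj_of_isFiniteEtaleCoveringGlobal hglob ⟨hH⟩ ⟨hG⟩
    (SgA.everyEdgeAbuts H)
  exact ⟨BObj.toCovObj A,
    ProfiniteSemiGraph.FiniteIsTempered_holds G.toSgA.toProfinite hG hκ _ (BObj.toCovObj_isFinite A), hA⟩

/-- **The tempered arrows of `SgA` between connected objects over a countable target are EXACTLY the
tempered coverings of Def. 3.5 (ii)**: the first disjunct of abc-iut-L3-t3's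
`SgA.IsTemperedArrow := finiteEtale ∨ IsTemperedCoveringOf` is redundant there.
[cite: MochizukiSemiAnbd2006, Def 3.5(ii) p.37] -/
theorem isTemperedArrow_iff_isTemperedCoveringOf (hH : H.toSgA.graph.IsConnected)
    (hG : G.toSgA.graph.IsConnected) (hκ : G.toSgA.graph.IsCountable) :
    IsTemperedArrow f ↔ IsTemperedCoveringOf f :=
  ⟨fun h => h.elim (isTemperedCoveringOf_of_finiteEtale f hH hG hκ) id,
    isTemperedArrow_of_isTemperedCoveringOf f⟩

end SgAQuot.SgA

/-- **The §§4–5 container at the real vocabulary**: for connected objects `H`, `G` of the ambient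
category with `G` countable, an arrow `f : H → G` is tempered for `SemiAnbdVocab.real` iff it is a
tempered covering of `G` in the sense of [SemiAnbd] Def. 3.5 (ii) read on profinite presentations
(abc-iut-L3-t3 `SgA.IsTemperedCoveringOf`). [cite: MochizukiSemiAnbd2006, Def 3.5(ii) p.37] -/
theorem SemiAnbdVocab.real_isTempered_iff_isTemperedCoveringOf {H G : SgAQuot.SgA.{u, u, u}} (f : H ⟶ G)
    (hH : H.toSgA.graph.IsConnected) (hG : G.toSgA.graph.IsConnected)
    (hκ : G.toSgA.graph.IsCountable) :
    SemiAnbdVocab.real.IsTempered f ↔ SgAQuot.SgA.IsTemperedCoveringOf f := by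
  rw [SemiAnbdVocab.real_isTempered_iff]
  exact SgAQuot.SgA.isTemperedArrow_iff_isTemperedCoveringOf f hH hG hκ

end Literature.AnabelianGeometry.SemiGraphs

end
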